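import Summits.RiemannHypothesis.RiemannHypothesis.Theses.LiTailMidpoint
import Summits.RiemannHypothesis.RiemannHypothesis.Theorems.LiTailMidpointBridgeFresnel
import Summits.RiemannHypothesis.RiemannHypothesis.Theorems.LiTailLaguerreBridgeCoffey
import HarnessLib

/-!
# RiemannHypothesis / LiTailMidpoint — crux K2 `LiBridgeHalves` (DECIDING): the Laguerre bridge is HALVED by its
# stationary height (RH-FREE, pure analysis)

RH-FREE [rh-li-eng-4 g6].  Route `Theses/LiTailMidpoint.lean` (round 8 of the LI column, theory g10; rung leaf «Li TAIL MIDPOINT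
LAW» `LiTheory.LiZeroTailMidpoint`, PROOF-OF-DATA, NOT height-buying), item `LiBridgeHalves` (stmt-RiemannHypothesis-19864): for
every `y > 0` there are `N`, `C` with

  `|liBridgeTail n y T − (π/2) e^{−y/2} L¹_{n−1}(y)| ≤ C log n`   (`n ≥ N`, `√(n/y) ≤ T ≤ √(n/y) + 1`),

`liBridgeTail n y T = ∫_T^∞ K`, `K(t) = 2(1 − cos nθ(t)) cos(ty)`, and `∫_0^∞ K = π e^{−y/2} L¹_{n−1}(y)` the PROVED Laguerre bridge
(`PrimeTail.integral_bridge_eq`, tail-p2).  Proof: `∫_T^∞ K − ½∫_0^∞ K = ½∫_0^∞ K − ∫_0^T K`; on `[0, L]`,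
`∫_0^L K = 2 sin(Ly)/y − Re ∫_0^L e^{iF} − Re ∫_0^L e^{iG}` (eng g6's `Fejer.bridge_trunc_eq`; `F = yt + nϑ` stationary at
`t₀ = √(n/y − ¼)`, `G` monotone with `|∫ e^{iG}| ≤ 2/y`), the far tail is `≤ n²/L` (`Fejer.abs_bridge_tail_le`), and the two
one-sided stationary integrals carry THE SAME half-Fresnel main term `M·fresnelLim`, `M = e^{iF(t₀)} F''(t₀)^{−1/2}`:
`∫_0^{t₀} e^{iF} = M·fresnelLim + O_y(log n)`, `∫_{t₀}^{L} e^{iF} = M·fresnelLim + O_y(log n)`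
(`BridgeFresnel.norm_integral_zero_tz_sub_le` / `norm_integral_tz_Ioi_sub_le`, from the uniform stationary-phase lemma
`Literature.Analysis.Fourier.stationaryPhase_uniform`), while `|∫_{t₀}^{T} e^{iF}| ≤ T − t₀ ≤ 2`; so in
`½ Re ∫_0^L e^{iF} − Re ∫_0^T e^{iF}` the main terms `½·2·M·fresnelLim − M·fresnelLim` CANCEL and everything else is `O_y(log n)`
(choose `L = max(2t₀, n²)`).  The `n^{1/4}` chirp is never evaluated.
Nothing here bears on the truth of RH: a statement about an explicit oscillatory integral and Laguerre polynomials.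
-/

noncomputable section

-- D-0017: `Summit.<S>.<S>.…` is the designed namespace of a single-problem summit.
set_option linter.dupNamespace false

open Set MeasureTheory intervalIntegral Complex
open Literature.Analysis.Fourier

namespace Summit.RiemannHypothesis.RiemannHypothesis.Theorems.LiTheory

namespace BridgeHalves

open Fejer BridgeFresnel

/-- The threshold: for `n ≥ ⌈5y⌉ + 2` one has `2 ≤ n`, `2y ≤ n`, `t₀ ≥ 2`, and every cut `T ∈ [√(n/y), √(n/y) + 1]` satisfies
`t₀ ≤ T ≤ t₀ + 2 ≤ 2t₀`. -/
theorem threshold {y : ℝ} (hy : 0 < y) {n : ℕ} (hn : ⌈5 * y⌉₊ + 2 ≤ n) {T : ℝ}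
    (hT1 : 1 / Real.sqrt y * Real.sqrt n ≤ T) (hT2 : T ≤ 1 / Real.sqrt y * Real.sqrt n + 1) :
    2 ≤ n ∧ 2 * y ≤ (n : ℝ) ∧ 2 ≤ tz n y ∧ tz n y ≤ T ∧ T ≤ tz n y + 2 ∧ T ≤ 2 * tz n y := by
  have hn2 : 2 ≤ n := by omega
  have hnr : (⌈5 * y⌉₊ : ℝ) + 2 ≤ n := by exact_mod_cast hn
  have h5 : 5 * y ≤ n := (Nat.le_ceil _).trans (by linarith)
  have h2y : 2 * y ≤ (n : ℝ) := by linarith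
  obtain ⟨hsq, h1, _, _⟩ := tz_facts hy h2y
  have hny : (n : ℝ) / y - 1 / 4 ≥ 4 := by
    rw [ge_iff_le, le_sub_iff_add_le, le_div_iff₀ hy]; linarith
  have hs2 : 2 ≤ tz n y := by
    unfold tz
    rw [show (2 : ℝ) = Real.sqrt (2 ^ 2) by rw [Real.sqrt_sq (by norm_num)]]
    exact Real.sqrt_le_sqrt (by linarith)
  have hroot : 1 / Real.sqrt y * Real.sqrt n = Real.sqrt (n / y) := by
    rw [Real.sqrt_div' _ hy.le]; ring
  rw [hroot] at hT1 hT2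
  -- `t₀ ≤ √(n/y) ≤ t₀ + 1`
  have hlo : tz n y ≤ Real.sqrt (n / y) := by
    unfold tz; exact Real.sqrt_le_sqrt (by linarith)
  have hhi : Real.sqrt (n / y) ≤ tz n y + 1 := by
    rw [Real.sqrt_le_left (by linarith)]
    nlinarith
  exact ⟨hn2, h2y, hs2, hlo.trans hT1, by linarith, by linarith⟩

/-- **Crux K2 `LiBridgeHalves`, explicit form** (RH-FREE): for `y > 0`, `n ≥ ⌈5y⌉ + 2` and `√(n/y) ≤ T ≤ √(n/y) + 1`,
`|liBridgeTail n y T − (π/2) e^{−y/2} liLaguerreOne n y| ≤ C_y log n` with an explicit `C_y`. -/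
theorem liBridgeHalves_bound (y : ℝ) (hy : 0 < y) :
    ∃ N : ℕ, ∃ C : ℝ, ∀ n : ℕ, N ≤ n → ∀ T : ℝ,
      1 / Real.sqrt y * Real.sqrt n ≤ T → T ≤ 1 / Real.sqrt y * Real.sqrt n + 1 →
        |liBridgeTail n y T - Real.pi / 2 * (Real.exp (-(y / 2)) * liLaguerreOne n y)| ≤ C * Real.log n := by
  set Ky : ℝ := 2 * 320 ^ 3 * 40000 / y with hKy
  have hKy0 : 0 ≤ Ky := by positivity
  set C0 : ℝ := 4 * Ky + 151 / y + 5 / 2 with hC0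
  set C1 : ℝ := 4 * Ky with hC1
  have hl2 : 0 < Real.log 2 := Real.log_pos (by norm_num)
  refine ⟨⌈5 * y⌉₊ + 2, C0 / Real.log 2 + C1, fun n hn T hT1 hT2 ↦ ?_⟩
  obtain ⟨hn2, h2y, hs2, hsT, hTs, hT2s⟩ := threshold hy hn hT1 hT2
  have hn1 : 1 ≤ n := by omega
  have hnr : (2 : ℝ) ≤ n := by exact_mod_cast hn2
  set s := tz n y with hs
  have hs0 : 0 < s := by linarith
  have hT0 : 0 ≤ T := by linarith
  have hlogn : Real.log 2 ≤ Real.log n := Real.log_le_log (by norm_num) hnr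
  have hlog0 : 0 ≤ Real.log n := hl2.le.trans hlogn
  -- the main term
  set M : ℂ := cexp (I * phF n y s) * ((Real.sqrt (phF2 n s))⁻¹ : ℝ) with hM
  have hEc : Continuous fun t : ℝ ↦ cexp (I * phF n y t) := by have := continuous_phF n y; fun_prop
  have hEi : ∀ a b : ℝ, IntervalIntegrable (fun t : ℝ ↦ cexp (I * phF n y t)) volume a b :=
    fun a b ↦ hEc.intervalIntegrable a b
  -- `L = max(2t₀, n²)`
  set L : ℝ := max (2 * s) ((n : ℝ) ^ 2) with hL
  have hL2s : 2 * s ≤ L := le_max_left _ _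
  have hLn : (n : ℝ) ^ 2 ≤ L := le_max_right _ _
  have hL0 : 0 < L := by positivity
  -- ### the exact identities (all real)
  have hfull : ∫ t in Ioi (0 : ℝ), 2 * (1 - Real.cos (n * liZeroAngle t)) * Real.cos (t * y)
      = Real.pi * (Real.exp (-(y / 2)) * liLaguerreOne n y) := PrimeTail.integral_bridge_eq n hn1 hy
  have hsplitT : ∫ t in Ioi (0 : ℝ), 2 * (1 - Real.cos (n * liZeroAngle t)) * Real.cos (t * y)
      = (∫ t in (0 : ℝ)..T, 2 * (1 - Real.cos (n * liZeroAngle t)) * Real.cos (t * y)) + liBridgeTail n y T := by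
    rw [liBridgeTail]; exact bridge_split n y hT0
  have hsplitL := bridge_split n y hL0.le
  have htruncL := bridge_trunc_eq n hy hL0.le
  have htruncT := bridge_trunc_eq n hy hT0
  have hF0L : (∫ t in (0 : ℝ)..L, cexp (I * phF n y t)).re
      = (∫ t in (0 : ℝ)..s, cexp (I * phF n y t)).re + (∫ t in s..L, cexp (I * phF n y t)).re := by
    rw [← integral_add_adjacent_intervals (hEi 0 s) (hEi s L), Complex.add_re]
  have hF0T : (∫ t in (0 : ℝ)..T, cexp (I * phF n y t)).re
      = (∫ t in (0 : ℝ)..s, cexp (I * phF n y t)).re + (∫ t in s..T, cexp (I * phF n y t)).re := by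
    rw [← integral_add_adjacent_intervals (hEi 0 s) (hEi s T), Complex.add_re]
  set e1 : ℂ := (∫ t in (0 : ℝ)..s, cexp (I * phF n y t)) - M * fresnelLim with he1
  set e2 : ℂ := (∫ t in s..L, cexp (I * phF n y t)) - M * fresnelLim with he2
  have he1re : e1.re = (∫ t in (0 : ℝ)..s, cexp (I * phF n y t)).re - (M * fresnelLim).re := by
    rw [he1, Complex.sub_re]
  have he2re : e2.re = (∫ t in s..L, cexp (I * phF n y t)).re - (M * fresnelLim).re := by
    rw [he2, Complex.sub_re]
  -- ### the bounds
  have hA1 : ‖e1‖ ≤ Ky * (2 + 2 * Real.log n) + 82 / y := norm_integral_zero_tz_sub_le hy h2y hn2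
  have hA2 : ‖e2‖ ≤ Ky * (2 + 2 * Real.log n) + 44 / y := norm_integral_tz_Ioi_sub_le hy h2y hn2 hL2s
  have hA3 : ‖∫ t in s..T, cexp (I * phF n y t)‖ ≤ 2 := by
    have h := intervalIntegral.norm_integral_le_of_norm_le_const (a := s) (b := T) (C := 1)
      (f := fun t : ℝ ↦ cexp (I * phF n y t)) (fun t _ ↦ (Complex.norm_exp_I_mul_ofReal _).le)
    rw [abs_of_nonneg (by linarith)] at h
    linarith
  have hG_L := norm_G_piece n hy hL0.le
  have hG_T := norm_G_piece n hy hT0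
  have htail := abs_bridge_tail_le n y hL0
  have htail1 : (n : ℝ) ^ 2 / L ≤ 1 := by rw [div_le_one hL0]; exact hLn
  have hsin1 : |Real.sin (L * y)| ≤ 1 := Real.abs_sin_le_one _
  have hsin2 : |Real.sin (T * y)| ≤ 1 := Real.abs_sin_le_one _
  -- real parts are bounded by norms
  have r1 := Complex.abs_re_le_norm e1
  have r2 := Complex.abs_re_le_norm e2
  have r3 := Complex.abs_re_le_norm (∫ t in s..T, cexp (I * phF n y t))
  have r4 := Complex.abs_re_le_norm (∫ t in (0 : ℝ)..L, cexp (I * phG n y t))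
  have r5 := Complex.abs_re_le_norm (∫ t in (0 : ℝ)..T, cexp (I * phG n y t))
  -- ### the main identity: the half-Fresnel terms cancel (linear bookkeeping)
  have hkey : liBridgeTail n y T - Real.pi / 2 * (Real.exp (-(y / 2)) * liLaguerreOne n y)
      = (Real.sin (L * y) / y - 2 * (Real.sin (T * y) / y))
        - (e1.re + e2.re) / 2 + (e1.re + (∫ t in s..T, cexp (I * phF n y t)).re)
        - (∫ t in (0 : ℝ)..L, cexp (I * phG n y t)).re / 2 + (∫ t in (0 : ℝ)..T, cexp (I * phG n y t)).re
        + (∫ t in Ioi L, 2 * (1 - Real.cos (n * liZeroAngle t)) * Real.cos (t * y)) / 2 := by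
    rw [he1re, he2re]
    linarith [hfull, hsplitT, hsplitL, htruncL, htruncT, hF0L, hF0T]
  rw [hkey]
  -- ### numerical assembly
  have hy1 : |Real.sin (L * y) / y| ≤ 1 / y := by
    rw [abs_div, abs_of_pos hy]; exact div_le_div_of_nonneg_right hsin1 hy.le
  have hy2 : |Real.sin (T * y) / y| ≤ 1 / y := by
    rw [abs_div, abs_of_pos hy]; exact div_le_div_of_nonneg_right hsin2 hy.le
  rw [abs_le] at hy1 hy2 r1 r2 r3 r4 r5 htail
  set P : ℝ := Ky * Real.log n with hP
  have eK : Ky * (2 + 2 * Real.log n) = 2 * Ky + 2 * P := by rw [hP]; ring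
  have eC : 4 * Ky * Real.log n = 4 * P := by rw [hP]; ring
  have hA1' : ‖e1‖ ≤ 2 * Ky + 2 * P + 82 / y := by linarith [hA1, eK]
  have hA2' : ‖e2‖ ≤ 2 * Ky + 2 * P + 44 / y := by linarith [hA2, eK]
  have hP0 : 0 ≤ P := mul_nonneg hKy0 hlog0
  have hyinv : 0 < 1 / y := by positivity
  -- all `c / y` as multiples of one atom `w = 1/y` (for `linarith`)
  set w : ℝ := 1 / y with hw
  have e2y : (2 : ℝ) / y = 2 * w := by rw [hw]; ring
  have e44 : (44 : ℝ) / y = 44 * w := by rw [hw]; ring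
  have e82 : (82 : ℝ) / y = 82 * w := by rw [hw]; ring
  have e151 : (151 : ℝ) / y = 151 * w := by rw [hw]; ring
  have esL : Real.sin (L * y) / y = Real.sin (L * y) * w := by rw [hw]; ring
  have esT : Real.sin (T * y) / y = Real.sin (T * y) * w := by rw [hw]; ring
  have hgoal : |Real.sin (L * y) / y - 2 * (Real.sin (T * y) / y)
        - (e1.re + e2.re) / 2 + (e1.re + (∫ t in s..T, cexp (I * phF n y t)).re)
        - (∫ t in (0 : ℝ)..L, cexp (I * phG n y t)).re / 2 + (∫ t in (0 : ℝ)..T, cexp (I * phG n y t)).re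
        + (∫ t in Ioi L, 2 * (1 - Real.cos (n * liZeroAngle t)) * Real.cos (t * y)) / 2|
      ≤ C0 + C1 * Real.log n := by
    rw [abs_le, hC0, hC1, eC]
    constructor <;> linarith [hy1.1, hy1.2, hy2.1, hy2.2, r1.1, r1.2, r2.1, r2.2, r3.1, r3.2, r4.1, r4.2,
      r5.1, r5.2, htail.1, htail.2, hA1', hA2', hA3, hG_L, hG_T, htail1, hP0, hyinv, hKy0,
      e2y, e44, e82, e151, esL, esT]
  refine hgoal.trans ?_
  -- `C0 + C1 log n ≤ (C0/log 2 + C1) log n`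
  have hC00 : 0 ≤ C0 := by positivity
  have h1 : C0 ≤ C0 / Real.log 2 * Real.log n := by
    rw [div_mul_eq_mul_div, le_div_iff₀ hl2]
    exact mul_le_mul_of_nonneg_left hlogn hC00
  have h2 : (C0 / Real.log 2 + C1) * Real.log n = C0 / Real.log 2 * Real.log n + C1 * Real.log n := by ring
  rw [h2]
  linarith

end BridgeHalves

open BridgeHalves in
/-- **Crux K2 `LiBridgeHalves` of route `LiTailMidpoint`** (stmt-RiemannHypothesis-19864; DECIDING; RH-FREE), verbatim the
route statement: for every `y > 0`, large `n` and every `T ∈ [√(n/y), √(n/y) + 1]`,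
`|liBridgeTail n y T − (π/2) e^{−y/2} liLaguerreOne n y| ≤ C_y log n`. -/
theorem liBridgeHalves_proof : Summit.RiemannHypothesis.RiemannHypothesis.Theses.LiTailMidpoint.LiBridgeHalves := by
  intro y hy
  exact liBridgeHalves_bound y hy

end Summit.RiemannHypothesis.RiemannHypothesis.Theorems.LiTheory

end
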